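import Literature.AlgebraicGeometry.Resolution.BlowupOffCentre
import Literature.AlgebraicGeometry.Resolution.SpreadRestrict
import Literature.AlgebraicGeometry.Resolution.StrictTransformClosedSetPieces
import Literature.AlgebraicGeometry.Resolution.StrictTransformBaseChange
import Literature.AlgebraicGeometry.Resolution.MarkedIdealsLemmas
import HarnessLib

/-!
# [OURS · L1 W4.5(b) · EL♮(3)] Rung TOWER₀, brick `towerPtRam_brick` part 1 — OFF-CENTRE TRANSPORT through a blow-up:
# a closed subscheme DISJOINT FROM THE CENTRE is unchanged (an iso over the blow-up), its strict transform is its total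
# transform, and — for a centre over ONE special point `y` of a model square — its special-fibre trace is the reduced
# topological strict transform `closure υ⁻¹(K ∖ {y})`
# (crux `EquisingularLiftNatThree` = stmt-ResolutionOfSingularities-20148, parent `EquisingularLiftNat` = stmt-…-20038)

HONEST FRAMING. OURS (cell res-hironaka, crux chain w45b, slot W4.5(b)); NOT a statement of any manuscript; AI-written, weaker
than expert review. Helper `--supports stmt-ResolutionOfSingularities-20148 --as helper`; closes nothing; no `sorry`; standard axioms;
DEF-FREE. res-L1-w45b-stub-4, object `towerPtRam_brick` = the K5-FAT MEMBER CLAUSE of the (pt-ram) tower step (res-L1-w45b-plan-1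
NAMING 2026-08-27T16:37:19Z (a); res-D-pv-029 g8 DESIGN FINDING 16:31:11Z §F2 «tower POINT steps at y ∉ closure K: centre ∩ V(𝒦) = ∅»
and RULING-5 (K EXACT-TRACE, γ-forget coupling): the shadow `𝒦` and the exceptional surface `𝓔` of the tower invariant are
TRANSPORTED through a point step only when the blown-up point is OFF them — and then the transport is the content of this file).

WHAT (centre-agnostic; `τ : X″ → X′` ANY blow-up along ANY ideal sheaf `C`, `I` any ideal sheaf with `supp I ∩ supp C = ∅`):
* `exists_iso_subscheme_comap_of_disjoint` — (E1) **`V(I·𝒪_{X″}) ≅ V(I)` over `τ`**: the cartesian square of `I.comap τ`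
  (`isPullback_subschemeMap`) restricted over the open complement of the centre, where `τ` is an isomorphism (Stacks 02OS,
  `IsBlowup.isIso_compl`), by pullback pasting (`IsPullback.of_bot`, `isIso_fst_of_isIso`). This `e` is exactly the input of
  res-D-pv-051's (T1)–(T3) (…NatConeRoundTransport, p549332), so the iso passes to the special fibres of a model square for free.
* `isRegular_subscheme_comap_of_disjoint` — (E2) hence `V(I·𝒪_{X″})` is regular when `V(I)` is.
* `strictTransformIdeal_eq_comap_of_disjoint` — (E3) `St_τ(I) = I·𝒪_{X″}` (stalkwise: off the centre by
  `IsBlowup.stalkIdeal_strictTransformIdeal_of_not_mem`, over the centre both are the unit ideal).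
* `closure_preimage_closure_diff_support_singleton` — for a blow-up `υ` along ANY `J` with `supp J = {y}`:
  `closure υ⁻¹(closure K ∖ {y}) = closure υ⁻¹(K ∖ {y})` (the point-centre lemma `closure_preimage_closure_diff_singleton` of
  …NatRegularPointStepExact, verbatim for a fat centre).
* `comap_comap_eq_vanishingIdeal_of_disjoint` — (E4) in a model square `j₂ ≫ τ = υ ≫ j` with `IsBlowup υ J`, `supp J = {y}`,
  `I·𝒪_F = 𝓘⟨closure K⟩` and `y ∉ closure K`: **`(I·𝒪_{X″})·𝒪_{F₂} = 𝓘⟨closure υ⁻¹(K ∖ {y})⟩`** (Literature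
  `IsBlowup.comap_vanishingIdeal_of_disjoint`: the reduced ideal of a closed set disjoint from the centre pulls back reduced).
* `disjoint_support_of_inter_fibre_eq_singleton` — (E5) over `Spec` of a local ring with a universally closed structure map:
  if `supp C` meets the special fibre in `{b}` only and `b ∉ supp I`, then `supp I ∩ supp C = ∅` (the closed image of
  `supp I ∩ supp C` would contain the closed point).

References: U. Görtz, T. Wedhorn, *Algebraic Geometry I* (2nd ed. 2020), Prop. 13.91 (3), (13.19) p. 414 [GortzWedhorn2020]; The Stacks
Project, Tags 02OS, 033B [StacksProject] — through the cited tree files (`BlowupOffCentre`, `SpreadRestrict`, `StrictTransformClosedSetPieces`).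
OURS planning texts (index only): res-D-pv-029 STATUS 2026-08-27T16:31:11Z / 16:37:13Z / 16:49:44Z; res-L1-w45b-plan-1 16:37:19Z.
-/

set_option linter.dupNamespace false -- mandated namespace `Summit.<Summit>.<Problem>` of this single-conjunct summit

noncomputable section

open CategoryTheory CategoryTheory.Limits AlgebraicGeometry TopologicalSpace Topology
open Literature.AlgebraicGeometry.Resolution
open AlgebraicGeometry.Scheme.IdealSheafData

namespace Summit.ResolutionOfSingularities.ResolutionOfSingularities.Cruxes.EquisingularLiftNat.Sections

/-! ## (E1)–(E3) A closed subscheme disjoint from the centre -/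

section OffCentre

variable {X X' : Scheme.{0}} {τ : X' ⟶ X} {C : X.IdealSheafData}

/-- **(E1) A closed subscheme disjoint from the centre is unchanged by the blow-up**: for a blow-up `τ : X′ → X` along
`C` and an ideal sheaf `I` with `supp I ∩ supp C = ∅` there is an isomorphism `e : V(I·𝒪_{X′}) ≅ V(I)` over `τ`
(`e ≫ ι_I = ι_{I·𝒪_{X′}} ≫ τ`). [cite: GortzWedhorn2020, Prop. 13.91 (3) p. 414] [cite: StacksProject, Tag 02OS] -/
theorem exists_iso_subscheme_comap_of_disjoint (hτ : IsBlowup τ C) (I : X.IdealSheafData)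
    (hI : Disjoint (I.support : Set X) (C.support : Set X)) :
    ∃ e : (I.comap τ).subscheme ≅ I.subscheme, e.hom ≫ I.subschemeι = (I.comap τ).subschemeι ≫ τ := by
  haveI : IsIso (τ ∣_ centreCompl C) := hτ.isIso_compl
  -- the two closed immersions factor through the open complement of the centre and its preimage
  have hrange : Set.range I.subschemeι ⊆ Set.range (centreCompl C).ι := by
    rw [range_subschemeι, Scheme.Opens.range_ι]
    exact hI.subset_compl_right
  have hrange' : Set.range (I.comap τ).subschemeι ⊆ Set.range (τ ⁻¹ᵁ centreCompl C).ι := by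
    rw [range_subschemeι, Scheme.Opens.range_ι, support_comap]
    intro x hx
    exact hI.subset_compl_right hx
  set ιU := IsOpenImmersion.lift (centreCompl C).ι I.subschemeι hrange with hιU_def
  have hιU : ιU ≫ (centreCompl C).ι = I.subschemeι := IsOpenImmersion.lift_fac _ _ _
  set ιU' := IsOpenImmersion.lift (τ ⁻¹ᵁ centreCompl C).ι (I.comap τ).subschemeι hrange' with hιU'_def
  have hιU' : ιU' ≫ (τ ⁻¹ᵁ centreCompl C).ι = (I.comap τ).subschemeι := IsOpenImmersion.lift_fac _ _ _
  -- the cartesian square of `I.comap τ`, cut down over the open complement of the centre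
  have H := isPullback_subschemeMap τ I
  have p : subschemeMap (I.comap τ) I τ (I.le_map_comap τ) ≫ ιU = ιU' ≫ (τ ∣_ centreCompl C) := by
    rw [← cancel_mono (centreCompl C).ι, Category.assoc, hιU, subschemeMap_subschemeι, Category.assoc,
      morphismRestrict_ι, ← Category.assoc, hιU']
  have s : IsPullback (subschemeMap (I.comap τ) I τ (I.le_map_comap τ)) (ιU' ≫ (τ ⁻¹ᵁ centreCompl C).ι)
      (ιU ≫ (centreCompl C).ι) τ := by
    rw [hιU, hιU']
    exact H
  have H' := IsPullback.of_bot s p (isPullback_morphismRestrict τ (centreCompl C))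
  haveI := H'.isIso_fst_of_isIso
  exact ⟨asIso (subschemeMap (I.comap τ) I τ (I.le_map_comap τ)), subschemeMap_subschemeι _ _ _ (I.le_map_comap τ)⟩

/-- **(E2) A regular closed subscheme disjoint from the centre stays regular**: `V(I·𝒪_{X′})` is regular when `V(I)` is
and `supp I ∩ supp C = ∅`. [cite: GortzWedhorn2020, Prop. 13.91 (3) p. 414] -/
theorem isRegular_subscheme_comap_of_disjoint (hτ : IsBlowup τ C) (I : X.IdealSheafData)
    (hI : Disjoint (I.support : Set X) (C.support : Set X)) (hreg : Scheme.IsRegular I.subscheme) :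
    Scheme.IsRegular (I.comap τ).subscheme := by
  obtain ⟨e, -⟩ := exists_iso_subscheme_comap_of_disjoint hτ I hI
  exact Scheme.IsRegular.of_iso e.inv hreg

/-- (E2, pointwise) The stalks of `V(I·𝒪_{X′})` are those of `V(I)`: at a point `z` the local ring of `V(I·𝒪_{X′})` is
regular iff the local ring of `V(I)` at the corresponding point `e z` is. [cite: GortzWedhorn2020, Prop. 13.91 (3) p. 414] -/
theorem exists_iso_forall_isRegularLocalRing_stalk_iff_of_disjoint (hτ : IsBlowup τ C) (I : X.IdealSheafData)
    (hI : Disjoint (I.support : Set X) (C.support : Set X)) :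
    ∃ e : (I.comap τ).subscheme ≅ I.subscheme, e.hom ≫ I.subschemeι = (I.comap τ).subschemeι ≫ τ ∧
      ∀ z : ↥(I.comap τ).subscheme, IsRegularLocalRing ((I.comap τ).subscheme.presheaf.stalk z) ↔
        IsRegularLocalRing (I.subscheme.presheaf.stalk (e.hom z)) := by
  obtain ⟨e, he⟩ := exists_iso_subscheme_comap_of_disjoint hτ I hI
  refine ⟨e, he, fun z => ?_⟩
  have eR := (asIso (e.hom.stalkMap z)).commRingCatIsoToRingEquiv
  exact ⟨fun h => IsRegularLocalRing.of_ringEquiv eR.symm, fun h => IsRegularLocalRing.of_ringEquiv eR⟩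

/-- **(E3) Off the centre the strict transform is the total transform**: `St_τ(I) = I·𝒪_{X′}` when
`supp I ∩ supp C = ∅` (stalkwise: off `τ⁻¹V(C)` by `IsBlowup.stalkIdeal_strictTransformIdeal_of_not_mem`, over `V(C)` both
stalks are the unit ideal since `τ⁻¹V(C) ∩ τ⁻¹ supp I = ∅`). [cite: GortzWedhorn2020, (13.19) p. 414] -/
theorem strictTransformIdeal_eq_comap_of_disjoint [IsLocallyNoetherian X] [IsLocallyNoetherian X'] (hτ : IsBlowup τ C)
    (I : X.IdealSheafData) (hI : Disjoint (I.support : Set X) (C.support : Set X)) :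
    strictTransformIdeal τ C I = I.comap τ := by
  refine ext_of_forall_stalkIdeal_eq fun x' => ?_
  by_cases hx : τ x' ∈ (C.support : Set X)
  · have hxI : τ x' ∉ (I.support : Set X) := fun h => hI.le_bot ⟨h, hx⟩
    have h1 : x' ∉ (I.comap τ).support := by
      rw [support_comap]
      exact hxI
    have h2 : stalkIdeal (I.comap τ) x' = ⊤ := stalkIdeal_eq_top_of_not_mem_support h1
    rw [h2]
    exact eq_top_iff.mpr (h2 ▸ stalkIdeal_mono (comap_le_strictTransformIdeal τ C I) x')
  · exact hτ.stalkIdeal_strictTransformIdeal_of_not_mem I hx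

/-- (E3′) hence the strict transform of `V(I)` is also regular when `V(I)` is and misses the centre.
[cite: GortzWedhorn2020, Prop. 13.91 (3) p. 414] -/
theorem isRegular_subscheme_strictTransformIdeal_of_disjoint [IsLocallyNoetherian X] [IsLocallyNoetherian X']
    (hτ : IsBlowup τ C) (I : X.IdealSheafData) (hI : Disjoint (I.support : Set X) (C.support : Set X))
    (hreg : Scheme.IsRegular I.subscheme) : Scheme.IsRegular (strictTransformIdeal τ C I).subscheme := by
  rw [strictTransformIdeal_eq_comap_of_disjoint hτ I hI]
  exact isRegular_subscheme_comap_of_disjoint hτ I hI hreg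

/-- (E1′) Principal stalks pull back to principal stalks (any morphism). [folklore] -/
theorem isPrincipal_stalkIdeal_comap {Y Y' : Scheme.{0}} (f : Y' ⟶ Y) (I : Y.IdealSheafData) (x : Y')
    (h : (stalkIdeal I (f x)).IsPrincipal) : (stalkIdeal (I.comap f) x).IsPrincipal := by
  rw [stalkIdeal_comap_eq_map_stalkMap]
  obtain ⟨a, ha⟩ := h
  exact ⟨⟨(f.stalkMap x).hom a, by rw [ha, Ideal.submodule_span_eq, Ideal.map_span, Set.image_singleton]⟩⟩

end OffCentre

/-! ## (E4) The special-fibre trace through a model square whose centre lies over one special point -/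

section Fibre

variable {G G' : Scheme.{0}} {υ : G' ⟶ G} {J : G.IdealSheafData}

/-- For a blow-up `υ` along ANY centre supported at the single point `y` and any `K ⊆ G`:
`closure υ⁻¹(closure K ∖ {y}) = closure υ⁻¹(K ∖ {y})` (over `G ∖ {y}` the blow-up is an open immersion).
[cite: GortzWedhorn2020, Prop. 13.91 (3) p. 414] -/
theorem closure_preimage_closure_diff_support_singleton (hυ : IsBlowup υ J) {y : G}
    (hJ : (J.support : Set G) = {y}) (K : Set G) :
    closure (υ ⁻¹' (closure K \ {y})) = closure (υ ⁻¹' (K \ {y})) := by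
  have hy : IsClosed ({y} : Set G) := hJ ▸ J.support.isClosed
  refine Set.Subset.antisymm (closure_minimal ?_ isClosed_closure)
    (closure_mono (Set.preimage_mono fun z hz => ⟨subset_closure hz.1, hz.2⟩))
  rintro x' ⟨hxK, hxy⟩
  have h1 : υ x' ∈ closure (K \ {y}) := by
    have h2 : closure K \ {y} ⊆ closure (K \ {y}) := by
      rw [Set.sdiff_eq, Set.sdiff_eq]
      exact hy.isOpen_compl.closure_inter
    exact h2 ⟨hxK, hxy⟩
  refine hυ.preimage_closure_diff_support_subset (K \ {y}) ⟨h1, ?_⟩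
  rw [Set.mem_preimage, hJ]
  exact hxy

/-- For a blow-up `υ` along a centre supported at `y` and a closed `K̄ ∌ y`: `υ⁻¹ K̄ = closure υ⁻¹(K̄ ∖ {y})` and both are
closed. [cite: GortzWedhorn2020, Prop. 13.91 (3) p. 414] -/
theorem preimage_eq_closure_preimage_diff_of_not_mem (hυ : IsBlowup υ J) {y : G}
    (hJ : (J.support : Set G) = {y}) (K : Set G) (hyK : y ∉ closure K) :
    υ ⁻¹' closure K = closure (υ ⁻¹' (K \ {y})) := by
  rw [← closure_preimage_closure_diff_support_singleton hυ hJ K, Set.sdiff_singleton_eq_self hyK]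
  exact ((isClosed_closure.preimage υ.continuous).closure_eq).symm

variable {X X' : Scheme.{0}} {τ : X' ⟶ X} {j : G ⟶ X} {j' : G' ⟶ X'}

/-- **(E4) The special-fibre trace of the transported subscheme.** In a model square `j′ ≫ τ = υ ≫ j` with `υ` a blow-up
along `J`, `supp J = {y}`, an ideal sheaf `I` on `X` with `I·𝒪_G = 𝓘⟨closure K⟩` and `y ∉ closure K`:
`(I·𝒪_{X′})·𝒪_{G′} = 𝓘⟨closure υ⁻¹(K ∖ {y})⟩` — the pull-back of the REDUCED ideal of a closed set disjoint from the centre is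
the reduced ideal of its preimage (Stacks 033B over the open where `υ` is an open immersion). [cite: StacksProject, Tag 033B]
[cite: GortzWedhorn2020, (13.19) p. 414] -/
theorem comap_comap_eq_vanishingIdeal_of_not_mem [IsLocallyNoetherian G] (hcomm : j' ≫ τ = υ ≫ j)
    (hυ : IsBlowup υ J) {y : G} (hJ : (J.support : Set G) = {y}) (I : X.IdealSheafData) (K : Set G)
    (hIK : I.comap j = vanishingIdeal ⟨closure K, isClosed_closure⟩) (hyK : y ∉ closure K) :
    (I.comap τ).comap j' = vanishingIdeal ⟨closure (υ ⁻¹' (K \ {y})), isClosed_closure⟩ := by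
  rw [← Scheme.IdealSheafData.comap_comp, hcomm, Scheme.IdealSheafData.comap_comp, hIK]
  have hdisj : Disjoint ((⟨closure K, isClosed_closure⟩ : Closeds G) : Set G) (J.support : Set G) := by
    rw [hJ]
    exact Set.disjoint_singleton_right.mpr hyK
  rw [hυ.comap_vanishingIdeal_of_disjoint _ hdisj]
  congr 1
  apply Closeds.ext
  change υ ⁻¹' closure K = closure (υ ⁻¹' (K \ {y}))
  exact preimage_eq_closure_preimage_diff_of_not_mem hυ hJ K hyK

/-- (E4′) The same with the strict transform: `St_τ(I)·𝒪_{G′} = 𝓘⟨closure υ⁻¹(K ∖ {y})⟩` once `supp I ∩ supp C = ∅`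
(then `St_τ I = I·𝒪_{X′}`, (E3)). [cite: GortzWedhorn2020, (13.19) p. 414] -/
theorem strictTransformIdeal_comap_eq_vanishingIdeal_of_not_mem [IsLocallyNoetherian G] [IsLocallyNoetherian X]
    [IsLocallyNoetherian X'] {C : X.IdealSheafData} (hτ : IsBlowup τ C) (hcomm : j' ≫ τ = υ ≫ j)
    (hυ : IsBlowup υ J) {y : G} (hJ : (J.support : Set G) = {y}) (I : X.IdealSheafData)
    (hI : Disjoint (I.support : Set X) (C.support : Set X)) (K : Set G)
    (hIK : I.comap j = vanishingIdeal ⟨closure K, isClosed_closure⟩) (hyK : y ∉ closure K) :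
    (strictTransformIdeal τ C I).comap j' = vanishingIdeal ⟨closure (υ ⁻¹' (K \ {y})), isClosed_closure⟩ := by
  rw [strictTransformIdeal_eq_comap_of_disjoint hτ I hI]
  exact comap_comap_eq_vanishingIdeal_of_not_mem hcomm hυ hJ I K hIK hyK

/-- `y ∉ closure K` read off the trace: if `I·𝒪_G = 𝓘⟨closure K⟩` then `y ∉ closure K ↔ j y ∉ supp I`. [folklore] -/
theorem not_mem_support_iff_of_comap_eq (I : X.IdealSheafData) (K : Set G)
    (hIK : I.comap j = vanishingIdeal ⟨closure K, isClosed_closure⟩) (y : G) :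
    j y ∉ (I.support : Set X) ↔ y ∉ closure K := by
  have h : y ∈ ((I.comap j).support : Set G) ↔ j y ∈ (I.support : Set X) := by
    rw [support_comap]; rfl
  rw [← not_iff_not.mpr h, hIK, Scheme.IdealSheafData.coe_support_vanishingIdeal]
  rfl

end Fibre

/-! ## (E5) A centre over one special point misses every closed subscheme not through that point -/

section Disjoint

/-- **(E5)** Over `Spec O`, `O` local, with a universally closed structure map `r : X → Spec O`: if the centre `C` meets the
special fibre in the single point `b` and `b ∉ supp I`, then `supp I ∩ supp C = ∅` — the image of the closed set
`supp I ∩ supp C` in `Spec O` is closed, and a nonempty closed subset of `Spec O` contains the closed point. [folklore;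
cite: StacksProject, Tag 01K0] -/
theorem disjoint_support_of_inter_fibre_eq_singleton {O : Type} [CommRing O] [IsLocalRing O] {X : Scheme.{0}}
    (r : X ⟶ Spec (.of O)) [UniversallyClosed r] (C I : X.IdealSheafData) {b : X}
    (hCb : (C.support : Set X) ∩ r ⁻¹' {IsLocalRing.closedPoint O} = {b}) (hb : b ∉ (I.support : Set X)) :
    Disjoint (I.support : Set X) (C.support : Set X) := by
  rw [Set.disjoint_iff_inter_eq_empty]
  by_contra hne
  have hcl : IsClosed (r '' ((I.support : Set X) ∩ (C.support : Set X))) :=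
    r.isClosedMap _ (I.support.isClosed.inter C.support.isClosed)
  -- the closed point of `Spec O` lies in the (nonempty, closed) image
  have hmem : IsLocalRing.closedPoint O ∈ r '' ((I.support : Set X) ∩ (C.support : Set X)) := by
    by_contra hnot
    have hU : (⟨(r '' ((I.support : Set X) ∩ (C.support : Set X)))ᶜ, hcl.isOpen_compl⟩ :
        Opens (PrimeSpectrum O)) = ⊤ :=
      (IsLocalRing.closed_point_mem_iff).mp hnot
    have h1 := congrArg (fun U : Opens (PrimeSpectrum O) => ((U : Set (PrimeSpectrum O)))ᶜ) hU
    simp only [Opens.coe_mk, compl_compl, Opens.coe_top, Set.compl_univ] at h1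
    exact hne (Set.image_eq_empty.mp h1)
  obtain ⟨c, ⟨hcI, hcC⟩, hc⟩ := hmem
  have hcb : c = b := by
    have h1 : c ∈ (C.support : Set X) ∩ r ⁻¹' {IsLocalRing.closedPoint O} := ⟨hcC, hc⟩
    rw [hCb] at h1
    exact h1
  exact hb (hcb ▸ hcI)

end Disjoint

end Summit.ResolutionOfSingularities.ResolutionOfSingularities.Cruxes.EquisingularLiftNat.Sections

end
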